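import Summits.BirchSwinnertonDyer.BirchSwinnertonDyer.Theorems.ByReductionTypeAtTwoSupersingularFlatBlindTwistSideLocalIndex
import Summits.BirchSwinnertonDyer.Rank1Residual.X11b.BDPRouteSelmerLevelBound
import Summits.BirchSwinnertonDyer.Rank1Residual.GaloisImage.LocalH1TorsionBounded
import Literature.NumberTheory.EllipticCurves.ArchimedeanH1CardLeTwo
import HarnessLib

/-!
# Selmer structures on `E[n]` that are Kummer away from `S₀ ∪ {v} ∪ ∞`: the strict count and the relaxation
# index against the `S₀ ∪ ∞` slack (hand HT-2 of crux `SupersingularRankZeroAtTwo`, twist side)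

Cell `bsd-2adic`, seat `bsd-2adic-tower-1` GEN 58, `--supports stmt-BirchSwinnertonDyer-19097` (helper). HONEST FRAMING:
THEOREMS ONLY (no `def`, no named fact, no instance, no `sorry`); nothing is booked; `SupersingularRankZeroAtTwo`,
CDF_glob and BSD are NOT proved by any of this.

## What

For an elliptic curve `E = W` over a number field `K`, a level `n`, a finite place `v` and a finite set `S₀` of finite
places, consider Selmer structures `𝓢` on `E[n]` that AGREE WITH THE KUMMER STRUCTURE at every finite place
`v' ∉ S₀ ∪ {v}` — nothing is assumed at `S₀` or at the infinite places (this is the shape of the structures the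
hand `HT2_exists_bound_strict_mul_relindex` transports to the quadratic twist `W₂`). With the «slack» subgroup
`N = (⨅_{w ∣ ∞} 𝓢_w(E)) ⊓ (⨅_{v' ∈ S₀} 𝓢_{v'}(E)) ≤ H¹(K, E[n])` (`selmerLocalKer`, the Kummer conditions at
`S₀ ∪ ∞`):

* §1 `index_slack_le` — `[H¹(K, E[n]) : N] ≤ 2^{#(w ∣ ∞)} · ∏_{v' ∈ S₀} [H¹ : 𝓢_{v'}]`, and the factors are finite
  and, for `n = p^k` and `v' ∤ p`, BOUNDED UNIFORMLY in `k` (`index_selmerLocalKer_le_of_not_mem`: `≤ B²` with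
  `#E(K_{v'})[m] ≤ B`, from `GaloisImage.natCard_galoisCohomology_one_torsion_adicCompletion_eq_sq_of_not_mem`;
  `index_selmerLocalKer_infinitePlace_le_two` at `∞`);
* §2 `natCard_selmerGroup_le_of_apply_eq_bot` — if `𝓢_v = 0`: **`#H¹_𝓢 ≤ [H¹ : N] · #(Sel⁽ⁿ⁾(E/K) ∩ ker res_v)`**
  (`H¹_𝓢 ∩ N ≤ Sel⁽ⁿ⁾ ∩ ker res_v`);
* §3 `relIndex_selmerGroup_le_of_kummer_le` — if `𝓢₁ ≤ 𝓢₂` agree off `v`, `𝓢₂,v = ⊤` and `𝓢₁,v ⊇ 𝓛_v` (the local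
  Kummer condition): **`[H¹_{𝓢₂} : H¹_{𝓢₁}] ≤ [H¹ : N] · [kummerOutside E n {v} : Sel⁽ⁿ⁾(E/K)]`**
  (`H¹_{𝓢₂} ∩ N ≤ kummerOutside E n {v}`, and intersecting with `loc_v⁻¹ 𝓛_v` lands in `H¹_{𝓢₁}`).

Combined with `…TwistSideLocalIndex.lean` (rank one ⇒ both right-hand factors bounded uniformly in `n = p^k`) this
bounds `#H¹_{𝓢^⊥} · [H¹_{𝓢^⊤} : H¹_{𝓢^K}]` uniformly — the W₂-side of the hand.

References: [JetchevSkinnerWan2017] Prop. 3.2.1; [MilneADT2006] I Rem. 3.7, Thm. 2.8, Lemma 3.3; [SilvermanAEC2009] X.§4;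
[MazurRubin2004] Def. 2.1.1 (Selmer structures).
-/

set_option autoImplicit false
set_option linter.dupNamespace false

noncomputable section

open scoped Classical

universe u

namespace Summit.BirchSwinnertonDyer.BirchSwinnertonDyer.Theorems.FlatBlindTwistSide

open Field NumberField IsDedekindDomain WeierstrassCurve Function
open Literature.NumberTheory.EllipticCurves Literature.NumberTheory.GaloisRepresentations
  Literature.NumberTheory.GaloisCohomology
open Literature.NumberTheory.GaloisRepresentations.DiscreteGaloisModule (SelmerStructure)

variable {K : Type} [Field K] [NumberField K] (W : WeierstrassCurve K) [W.IsElliptic]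

/-! ## §1 The slack: the Kummer conditions at `S₀ ∪ ∞` have finite, uniformly bounded index -/

/-- At a finite place `v' ∤ p` the Kummer condition `loc_{v'}⁻¹(𝓛_{v'}) ≤ H¹(K, E[p^k])` has non-zero index at most `B²`
for a `B` independent of `k ≥ 1` (`#E(K_{v'})[m] ≤ B` for all `m`, Milne I Lemma 3.3;
`[H¹ : loc⁻¹𝓛_{v'}] ≤ #H¹(K_{v'}, E[p^k]) = #E(K_{v'})[p^k]²`, Milne I Thm. 2.8 at `v' ∤ p`).
[cite: MilneADT2006, Ch. I §2 Thm. 2.8 and §3 Lemma 3.3] -/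
theorem exists_index_comap_kummer_le_of_not_mem (p : ℕ) [Fact p.Prime] (v' : HeightOneSpectrum (𝓞 K))
    (hpv' : ((p : ℕ) : 𝓞 K) ∉ v'.asIdeal) :
    ∃ D : ℕ, 0 < D ∧ ∀ k : ℕ, 1 ≤ k →
      ((W.kummerSelmerStructure (((p ^ k : ℕ) : ℤ)) (Sum.inr v')).comap
          (galoisCohomology.localization (W.torsionGaloisModule (((p ^ k : ℕ) : ℤ))) (Sum.inr v') 1)).index ≠ 0 ∧
      ((W.kummerSelmerStructure (((p ^ k : ℕ) : ℤ)) (Sum.inr v')).comap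
          (galoisCohomology.localization (W.torsionGaloisModule (((p ^ k : ℕ) : ℤ))) (Sum.inr v') 1)).index ≤ D := by
  have hp : p.Prime := Fact.out
  obtain ⟨B, hB, hBle⟩ :=
    Summit.BirchSwinnertonDyer.Rank1Residual.GaloisImage.exists_natCard_ker_nsmul_adicCompletion_le W v'
  refine ⟨B ^ 2, pow_pos hB 2, fun k hk ↦ ?_⟩
  obtain ⟨m, rfl⟩ := Nat.exists_eq_add_of_le' hk
  haveI : CharZero (v'.adicCompletion K) := charZero_of_injective_algebraMap (algebraMap K _).injective
  -- `#H¹(K_{v'}, E[p^{m+1}]) = #E(K_{v'})[p^{m+1}]²`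
  have hcard := Summit.BirchSwinnertonDyer.Rank1Residual.GaloisImage.natCard_galoisCohomology_one_torsion_adicCompletion_eq_sq_of_not_mem
    W v' p hpv' m
  haveI hfin : Finite (galoisCohomology
      (GaloisRep.restrictField (v'.adicCompletion K) (W.torsionGaloisModule ((p ^ (m + 1) : ℕ) : ℤ))) 1) := by
    haveI : NeZero (((p ^ (m + 1) : ℕ) : ℤ)) := ⟨by exact_mod_cast pow_ne_zero _ hp.ne_zero⟩
    haveI : Finite (geomTorsion W (((p ^ (m + 1) : ℕ) : ℤ))) := finite_geomTorsion_of_neZero W _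
    exact finite_galoisCohomology_one_of_isNonarchimedeanLocalField _
  rw [W.kummerSelmerStructure_apply]
  change ((W.kummerLocalConditionAt _ (v'.adicCompletion K)).comap
      (galoisCohomology.res (W.torsionGaloisModule (((p ^ (m + 1) : ℕ) : ℤ))) (v'.adicCompletion K) 1)).index ≠ 0 ∧
    ((W.kummerLocalConditionAt _ (v'.adicCompletion K)).comap
      (galoisCohomology.res (W.torsionGaloisModule (((p ^ (m + 1) : ℕ) : ℤ))) (v'.adicCompletion K) 1)).index ≤ B ^ 2
  rw [AddSubgroup.index_comap]
  refine ⟨fun h0 ↦ AddSubgroup.index_ne_zero_of_finite (AddSubgroup.index_eq_zero_of_relIndex_eq_zero h0), ?_⟩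
  refine le_trans (AddSubgroup.relIndex_le_of_le_right le_top ?_) ?_
  · rw [AddSubgroup.relIndex_top_right]; exact AddSubgroup.index_ne_zero_of_finite
  · rw [AddSubgroup.relIndex_top_right]
    refine (Nat.le_of_dvd Nat.card_pos (AddSubgroup.index_dvd_card _)).trans ?_
    rw [hcard]
    exact Nat.pow_le_pow_left (hBle _ (pow_ne_zero _ hp.ne_zero)) 2

/-- At an infinite place the Kummer condition `loc_w⁻¹(𝓛_w) ≤ H¹(K, E[n])` has index `≠ 0` and `≤ 2`
(Milne I Rem. 3.7: `#H¹(ℝ, E) ≤ 2`; tree `index_selmerLocalKer_infinitePlace_le_two`). [cite: MilneADT2006, Ch. I Rem. 3.7] -/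
theorem index_comap_kummer_infinitePlace_ne_zero_and_le_two (w : InfinitePlace K) (n : ℤ) (hn : n ≠ 0) :
    ((W.kummerSelmerStructure n (Sum.inl w)).comap
        (galoisCohomology.localization (W.torsionGaloisModule n) (Sum.inl w) 1)).index ≠ 0 ∧
    ((W.kummerSelmerStructure n (Sum.inl w)).comap
        (galoisCohomology.localization (W.torsionGaloisModule n) (Sum.inl w) 1)).index ≤ 2 := by
  haveI := finite_absoluteGaloisGroup_completion_infinitePlace w
  haveI := W.finite_galoisCohomology_one_torsion_restrictField_of_finite w.Completion hn
  rw [W.kummerSelmerStructure_apply]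
  change ((W.kummerLocalConditionAt n w.Completion).comap
      (galoisCohomology.res (W.torsionGaloisModule n) w.Completion 1)).index ≠ 0 ∧
    ((W.kummerLocalConditionAt n w.Completion).comap
      (galoisCohomology.res (W.torsionGaloisModule n) w.Completion 1)).index ≤ 2
  constructor
  · rw [AddSubgroup.index_comap]
    exact fun h0 ↦ AddSubgroup.index_ne_zero_of_finite (AddSubgroup.index_eq_zero_of_relIndex_eq_zero h0)
  · have h := W.index_selmerLocalKer_infinitePlace_le_two w n
    erw [← W.comap_res_kummerLocalConditionAt] at h
    exact h

/-! ## §2 Structures that are Kummer off `S₀ ∪ {v} ∪ ∞`: membership lemmas -/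

section Structures

variable (n : ℕ) [NeZero n] (v : HeightOneSpectrum (𝓞 K)) (S₀ : Finset (HeightOneSpectrum (𝓞 K)))

omit [W.IsElliptic] [NeZero n] in
/-- A class satisfying a structure `𝓢` that is Kummer at the finite places off `S₀ ∪ {v}`, AND the Kummer conditions at
`S₀ ∪ ∞` (the slack `N`), lies in `kummerOutside E n {v}` (it is Kummer everywhere except possibly at `v`).
[cite: SilvermanAEC2009, X.§4] -/
theorem mem_kummerOutside_of_mem_selmerGroup_of_mem_slack (𝓢 : SelmerStructure (W.torsionGaloisModule (n : ℤ)))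
    (hoff : ∀ v' : HeightOneSpectrum (𝓞 K), v' ∉ S₀ → v' ≠ v →
      𝓢 (Sum.inr v') = W.kummerSelmerStructure (n : ℤ) (Sum.inr v'))
    {x : galoisCohomology (W.torsionGaloisModule (n : ℤ)) 1} (hx : x ∈ 𝓢.selmerGroup)
    (hxN : x ∈ (⨅ w : InfinitePlace K, (W.kummerSelmerStructure (n : ℤ) (Sum.inl w)).comap
        (galoisCohomology.localization (W.torsionGaloisModule (n : ℤ)) (Sum.inl w) 1)) ⊓
      ⨅ v' ∈ S₀, (W.kummerSelmerStructure (n : ℤ) (Sum.inr v')).comap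
        (galoisCohomology.localization (W.torsionGaloisModule (n : ℤ)) (Sum.inr v') 1)) :
    x ∈ kummerOutside W n {Sum.inr v} := by
  rw [mem_kummerOutside_iff]
  have hloc := (SelmerStructure.mem_selmerGroup_iff 𝓢 x).mp hx
  obtain ⟨hxinf, hxS⟩ := AddSubgroup.mem_inf.mp hxN
  intro w hw
  rcases w with w | v'
  · have h := (AddSubgroup.mem_iInf.mp hxinf) w
    rw [AddSubgroup.mem_comap, W.kummerSelmerStructure_apply] at h
    exact h
  · by_cases hv'S : v' ∈ S₀
    · have h := (AddSubgroup.mem_iInf.mp ((AddSubgroup.mem_iInf.mp hxS) v')) hv'S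
      rw [AddSubgroup.mem_comap, W.kummerSelmerStructure_apply] at h
      exact h
    · have hv'v : v' ≠ v := fun h ↦ hw (by rw [h]; exact Finset.mem_singleton_self _)
      have h := hloc (Sum.inr v')
      rw [hoff v' hv'S hv'v, W.kummerSelmerStructure_apply] at h
      exact h

omit [W.IsElliptic] [NeZero n] in
/-- If moreover `𝓢_v = 0`, such a class is an `n`-Selmer class dying at `v`. [cite: SilvermanAEC2009, X.§4] -/
theorem mem_selmerGroup_inf_ker_of_apply_eq_bot (𝓢 : SelmerStructure (W.torsionGaloisModule (n : ℤ)))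
    (hoff : ∀ v' : HeightOneSpectrum (𝓞 K), v' ∉ S₀ → v' ≠ v →
      𝓢 (Sum.inr v') = W.kummerSelmerStructure (n : ℤ) (Sum.inr v'))
    (hv : 𝓢 (Sum.inr v) = ⊥)
    {x : galoisCohomology (W.torsionGaloisModule (n : ℤ)) 1} (hx : x ∈ 𝓢.selmerGroup)
    (hxN : x ∈ (⨅ w : InfinitePlace K, (W.kummerSelmerStructure (n : ℤ) (Sum.inl w)).comap
        (galoisCohomology.localization (W.torsionGaloisModule (n : ℤ)) (Sum.inl w) 1)) ⊓
      ⨅ v' ∈ S₀, (W.kummerSelmerStructure (n : ℤ) (Sum.inr v')).comap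
        (galoisCohomology.localization (W.torsionGaloisModule (n : ℤ)) (Sum.inr v') 1)) :
    x ∈ selmerGroup W (n : ℤ) ⊓
      (galoisCohomology.res (W.torsionGaloisModule (n : ℤ)) (v.adicCompletion K) 1).ker := by
  have hKO := mem_kummerOutside_of_mem_selmerGroup_of_mem_slack W n v S₀ 𝓢 hoff hx hxN
  have hv0 : galoisCohomology.localization (W.torsionGaloisModule (n : ℤ)) (Sum.inr v) 1 x = 0 := by
    have h := (SelmerStructure.mem_selmerGroup_iff 𝓢 x).mp hx (Sum.inr v)
    rw [hv] at h
    exact (AddSubgroup.mem_bot).mp h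
  refine AddSubgroup.mem_inf.mpr ⟨?_, hv0⟩
  refine (W.mem_selmerGroup_iff_forall_localization_mem (n : ℤ) x).mpr fun w ↦ ?_
  by_cases hw : w = Sum.inr v
  · subst hw
    rw [hv0]
    exact zero_mem _
  · have h := (mem_kummerOutside_iff W n {Sum.inr v} x).mp hKO w (by rwa [Finset.mem_singleton])
    rw [W.kummerSelmerStructure_apply]
    exact h

/-- **The strict count against the slack.** If `𝓢` is Kummer off `S₀ ∪ {v} ∪ ∞` and `𝓢_v = 0`, then
`#H¹_𝓢 ≤ [H¹ : N] · #(Sel⁽ⁿ⁾(E/K) ∩ ker res_v)` with `N` the slack (the Kummer conditions at `S₀ ∪ ∞`) of non-zero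
index. [cite: JetchevSkinnerWan2017, Prop. 3.2.1 (proof)] [cite: SilvermanAEC2009, X.§4] -/
theorem natCard_selmerGroup_le_of_apply_eq_bot (𝓢 : SelmerStructure (W.torsionGaloisModule (n : ℤ)))
    (hoff : ∀ v' : HeightOneSpectrum (𝓞 K), v' ∉ S₀ → v' ≠ v →
      𝓢 (Sum.inr v') = W.kummerSelmerStructure (n : ℤ) (Sum.inr v'))
    (hv : 𝓢 (Sum.inr v) = ⊥)
    (N : AddSubgroup (galoisCohomology (W.torsionGaloisModule (n : ℤ)) 1))
    (hNdef : N = (⨅ w : InfinitePlace K, (W.kummerSelmerStructure (n : ℤ) (Sum.inl w)).comap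
        (galoisCohomology.localization (W.torsionGaloisModule (n : ℤ)) (Sum.inl w) 1)) ⊓
      ⨅ v' ∈ S₀, (W.kummerSelmerStructure (n : ℤ) (Sum.inr v')).comap
        (galoisCohomology.localization (W.torsionGaloisModule (n : ℤ)) (Sum.inr v') 1))
    (hN : N.index ≠ 0) :
    Nat.card 𝓢.selmerGroup ≤ N.index *
      Nat.card ↥(selmerGroup W (n : ℤ) ⊓
        (galoisCohomology.res (W.torsionGaloisModule (n : ℤ)) (v.adicCompletion K) 1).ker) := by
  have hfinSel : Finite (selmerGroup W (n : ℤ)) := W.finite_selmerGroup_holds (Int.natCast_ne_zero.mpr (NeZero.ne n))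
  have hfinT : Finite ↥(selmerGroup W (n : ℤ) ⊓
      (galoisCohomology.res (W.torsionGaloisModule (n : ℤ)) (v.adicCompletion K) 1).ker) :=
    Finite.of_injective _ (AddSubgroup.inclusion_injective inf_le_left)
  have hsub : 𝓢.selmerGroup ⊓ N ≤ selmerGroup W (n : ℤ) ⊓
      (galoisCohomology.res (W.torsionGaloisModule (n : ℤ)) (v.adicCompletion K) 1).ker := fun x hx ↦
    mem_selmerGroup_inf_ker_of_apply_eq_bot W n v S₀ 𝓢 hoff hv (AddSubgroup.mem_inf.mp hx).1
      (hNdef ▸ (AddSubgroup.mem_inf.mp hx).2)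
  -- `#A = #(A ∩ N) · [A : A ∩ N]` and `[A : A ∩ N] = N.relIndex A ≤ [H¹ : N]`
  have hcard : Nat.card ↥(𝓢.selmerGroup ⊓ N) * (𝓢.selmerGroup ⊓ N).relIndex 𝓢.selmerGroup =
      Nat.card 𝓢.selmerGroup := by
    rw [← AddSubgroup.relIndex_bot_left, ← AddSubgroup.relIndex_bot_left,
      AddSubgroup.relIndex_mul_relIndex ⊥ (𝓢.selmerGroup ⊓ N) 𝓢.selmerGroup bot_le inf_le_left]
  have htop : N.relIndex ⊤ = N.index := AddSubgroup.relIndex_top_right N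
  have hrel : (𝓢.selmerGroup ⊓ N).relIndex 𝓢.selmerGroup ≤ N.index := by
    rw [AddSubgroup.inf_relIndex_left, ← htop]
    exact AddSubgroup.relIndex_le_of_le_right le_top (by rw [htop]; exact hN)
  have hAN : Nat.card ↥(𝓢.selmerGroup ⊓ N) ≤ Nat.card ↥(selmerGroup W (n : ℤ) ⊓
      (galoisCohomology.res (W.torsionGaloisModule (n : ℤ)) (v.adicCompletion K) 1).ker) :=
    Nat.card_le_card_of_injective _ (AddSubgroup.inclusion_injective hsub)
  calc Nat.card 𝓢.selmerGroup
      = Nat.card ↥(𝓢.selmerGroup ⊓ N) * (𝓢.selmerGroup ⊓ N).relIndex 𝓢.selmerGroup := hcard.symm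
    _ ≤ Nat.card ↥(selmerGroup W (n : ℤ) ⊓
          (galoisCohomology.res (W.torsionGaloisModule (n : ℤ)) (v.adicCompletion K) 1).ker) * N.index :=
        Nat.mul_le_mul hAN hrel
    _ = _ := mul_comm _ _

/-- **The relaxation index against the slack.** Let `𝓢₁ ≤ 𝓢₂` be Selmer structures on `E[n]` that agree away from
`v`, with `𝓢₂` Kummer off `S₀ ∪ {v} ∪ ∞` and `𝓢₁,v ⊇ 𝓛_v` (the local Kummer condition). Then
`[H¹_{𝓢₂} : H¹_{𝓢₁}] ≤ [H¹ : N] · [kummerOutside E n {v} : Sel⁽ⁿ⁾(E/K)]` (`H¹_{𝓢₂} ∩ N ⊆ kummerOutside E n {v}`, and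
its intersection with `Sel⁽ⁿ⁾` lies in `H¹_{𝓢₁}`). [cite: JetchevSkinnerWan2017, Prop. 3.2.1 (proof)] [cite: SilvermanAEC2009, X.§4] -/
theorem relIndex_selmerGroup_le_of_kummer_le (𝓢₁ 𝓢₂ : SelmerStructure (W.torsionGaloisModule (n : ℤ)))
    (heq : ∀ w : Place K, w ≠ Sum.inr v → 𝓢₁ w = 𝓢₂ w)
    (hoff : ∀ v' : HeightOneSpectrum (𝓞 K), v' ∉ S₀ → v' ≠ v →
      𝓢₂ (Sum.inr v') = W.kummerSelmerStructure (n : ℤ) (Sum.inr v'))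
    (hkum : W.kummerSelmerStructure (n : ℤ) (Sum.inr v) ≤ 𝓢₁ (Sum.inr v))
    (N : AddSubgroup (galoisCohomology (W.torsionGaloisModule (n : ℤ)) 1))
    (hNdef : N = (⨅ w : InfinitePlace K, (W.kummerSelmerStructure (n : ℤ) (Sum.inl w)).comap
        (galoisCohomology.localization (W.torsionGaloisModule (n : ℤ)) (Sum.inl w) 1)) ⊓
      ⨅ v' ∈ S₀, (W.kummerSelmerStructure (n : ℤ) (Sum.inr v')).comap
        (galoisCohomology.localization (W.torsionGaloisModule (n : ℤ)) (Sum.inr v') 1))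
    (hN : N.index ≠ 0) :
    (𝓢₁.selmerGroup).relIndex 𝓢₂.selmerGroup ≤
      N.index * (selmerGroup W (n : ℤ)).relIndex (kummerOutside W n {Sum.inr v}) := by
  have hfinKO : Finite (kummerOutside W n {Sum.inr v}) :=
    Summit.BirchSwinnertonDyer.Rank1Residual.X11b.SelmerLevelBound.finite_kummerOutside W n _
  -- `A ∩ N ≤ KO`
  have hA'KO : 𝓢₂.selmerGroup ⊓ N ≤ kummerOutside W n {Sum.inr v} := fun x hx ↦
    mem_kummerOutside_of_mem_selmerGroup_of_mem_slack W n v S₀ 𝓢₂ hoff (AddSubgroup.mem_inf.mp hx).1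
      (hNdef ▸ (AddSubgroup.mem_inf.mp hx).2)
  have hfinA' : Finite ↥(𝓢₂.selmerGroup ⊓ N) := Finite.of_injective _ (AddSubgroup.inclusion_injective hA'KO)
  -- `(A ∩ N) ∩ Sel ≤ B ∩ (A ∩ N)`
  have hSelB : (𝓢₂.selmerGroup ⊓ N) ⊓ selmerGroup W (n : ℤ) ≤ 𝓢₁.selmerGroup ⊓ (𝓢₂.selmerGroup ⊓ N) := by
    intro x hx
    obtain ⟨hxA', hxSel⟩ := AddSubgroup.mem_inf.mp hx
    refine AddSubgroup.mem_inf.mpr ⟨?_, hxA'⟩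
    have hxA := (AddSubgroup.mem_inf.mp hxA').1
    refine (SelmerStructure.mem_selmerGroup_iff 𝓢₁ x).mpr fun w ↦ ?_
    by_cases hw : w = Sum.inr v
    · subst hw
      exact hkum ((W.mem_selmerGroup_iff_forall_localization_mem (n : ℤ) x).mp hxSel (Sum.inr v))
    · rw [heq w hw]
      exact (SelmerStructure.mem_selmerGroup_iff 𝓢₂ x).mp hxA w
  -- non-vanishing of the relative indices
  have hNA : (𝓢₂.selmerGroup ⊓ N).relIndex 𝓢₂.selmerGroup ≠ 0 := by
    rw [AddSubgroup.inf_relIndex_left]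
    exact fun h ↦ hN (AddSubgroup.index_eq_zero_of_relIndex_eq_zero h)
  have hfinrel : ∀ (C D : AddSubgroup (galoisCohomology (W.torsionGaloisModule (n : ℤ)) 1)), Finite D →
      C.relIndex D ≠ 0 := fun C D hD ↦ by
    rw [AddSubgroup.relIndex]
    exact AddSubgroup.index_ne_zero_of_finite
  have h2 : (𝓢₁.selmerGroup ⊓ (𝓢₂.selmerGroup ⊓ N)).relIndex 𝓢₂.selmerGroup =
      (𝓢₁.selmerGroup ⊓ (𝓢₂.selmerGroup ⊓ N)).relIndex (𝓢₂.selmerGroup ⊓ N) *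
        (𝓢₂.selmerGroup ⊓ N).relIndex 𝓢₂.selmerGroup :=
    (AddSubgroup.relIndex_mul_relIndex _ _ _ inf_le_right inf_le_left).symm
  have h1 : (𝓢₁.selmerGroup).relIndex 𝓢₂.selmerGroup ≤
      (𝓢₁.selmerGroup ⊓ (𝓢₂.selmerGroup ⊓ N)).relIndex 𝓢₂.selmerGroup :=
    AddSubgroup.relIndex_le_of_le_left inf_le_left (by
      rw [h2]; exact mul_ne_zero (hfinrel _ _ hfinA') hNA)
  have h3 : (𝓢₁.selmerGroup ⊓ (𝓢₂.selmerGroup ⊓ N)).relIndex (𝓢₂.selmerGroup ⊓ N) ≤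
      (selmerGroup W (n : ℤ)).relIndex (kummerOutside W n {Sum.inr v}) :=
    calc (𝓢₁.selmerGroup ⊓ (𝓢₂.selmerGroup ⊓ N)).relIndex (𝓢₂.selmerGroup ⊓ N)
        ≤ ((𝓢₂.selmerGroup ⊓ N) ⊓ selmerGroup W (n : ℤ)).relIndex (𝓢₂.selmerGroup ⊓ N) :=
          AddSubgroup.relIndex_le_of_le_left hSelB (hfinrel _ _ hfinA')
      _ = (selmerGroup W (n : ℤ)).relIndex (𝓢₂.selmerGroup ⊓ N) := AddSubgroup.inf_relIndex_left _ _
      _ ≤ (selmerGroup W (n : ℤ)).relIndex (kummerOutside W n {Sum.inr v}) :=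
          AddSubgroup.relIndex_le_of_le_right hA'KO (hfinrel _ _ hfinKO)
  have htop : N.relIndex ⊤ = N.index := AddSubgroup.relIndex_top_right N
  have h4 : (𝓢₂.selmerGroup ⊓ N).relIndex 𝓢₂.selmerGroup ≤ N.index := by
    rw [AddSubgroup.inf_relIndex_left, ← htop]
    exact AddSubgroup.relIndex_le_of_le_right le_top (by rw [htop]; exact hN)
  calc (𝓢₁.selmerGroup).relIndex 𝓢₂.selmerGroup
      ≤ (𝓢₁.selmerGroup ⊓ (𝓢₂.selmerGroup ⊓ N)).relIndex 𝓢₂.selmerGroup := h1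
    _ = _ := h2
    _ ≤ (selmerGroup W (n : ℤ)).relIndex (kummerOutside W n {Sum.inr v}) * N.index := Nat.mul_le_mul h3 h4
    _ = _ := mul_comm _ _

end Structures

end Summit.BirchSwinnertonDyer.BirchSwinnertonDyer.Theorems.FlatBlindTwistSide

end
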